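import Mathlib
import HarnessLib

/-!
# Robust characterization of low-degree polynomials: the evenly-spaced-points test (Rubinfeld–Sudan)

Literature / complexity toolkit (low-degree testing, the algebraic engine of `MIP = NEXP` / PCP
verifiers for exponential-time computations). The **degree-`d` test on `d + 2` evenly spaced
points** of Rubinfeld–Sudan (*Robust characterizations of polynomials with applications to program
testing*, SIAM J. Comput. 25 (1996); Gemmell–Lipton–Rubinfeld–Sudan–Wigderson, STOC 1991, §3): for
`f : Fᵐ → F` pick `x, t ∈ Fᵐ` and check `∑_{i=0}^{d+1} αᵢ f(x + i·t) = 0`, where for the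
coefficients `αᵢ = (-1)^{d+1-i} (d+1 choose i)` the sum is the `(d+1)`-st finite difference
`Δ_t^{d+1} f (x)`, which vanishes identically for polynomials of total degree `≤ d`. The ROBUSTNESS
theorem says that a function passing the test on most pairs `(x, t)` is close to a function passing
it on ALL pairs; it is proved here by the printed three-step argument (plurality decoding `g`,
"`g` is `2δ`-close", "the vote for `g(x)` is overwhelming", "`g` passes everywhere"), as exact
counting statements over `Fᵐ × Fᵐ` for an arbitrary finite field `F`, arbitrary coefficients `α`
with `α₀ ≠ 0`, and `1, …, d + 1` nonzero in `F`:

* `LowDegreeTest.testSum α d f x t = ∑_{i < d+2} αᵢ f(x + i•t)`, `fails α d f` (the failing pairs),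
  `vote`, `corr` (plurality decoding);
* `card_ne_corr_mul_le` — `#{x | f x ≠ g x} · |Fᵐ| ≤ 2 · #fails` ("`dist(f, g) ≤ 2δ`");
* `card_vote_ne_mul_le` — for every `x`, `#{t | vote_t(x) ≠ g x} · |Fᵐ| ≤ 2(d+1) · #fails`
  (pairwise comparison of two votes through `2(d+1)` translated copies of the failure set, and
  the collision bound `∑ᵥ cᵥ² ≤ c_max ∑ᵥ cᵥ`);
* `testSum_corr_eq_zero` — if `(d+1)(2d+5) · #fails < |Fᵐ|²` then `g` passes the test at EVERY
  `(x, t)` (a good pair `(t₁, t₂)` exists for the `(d+2) × (d+2)` grid `x + i t + j (t₁ + i t₂)`);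
* **`robust`** — the packaged statement: under that hypothesis there is `g` with
  `#{f ≠ g} · |Fᵐ| ≤ 2 #fails` and `∀ x t, testSum α d g x t = 0`;
* the finite-difference instance over a field: `testSum (diffCoeff d) d f x t = Δ_[t]^[d+1] f x`
  (`testSum_diffCoeff`), completeness for polynomials of total degree `≤ d`
  (`fwdDiff_iter_eval_eq_zero`: Mathlib's `Polynomial.fwdDiff_iter_eq_zero_of_degree_lt` along the
  line `s ↦ x + s•t`), and the converse on lines over `ZMod p`: a function
  `u : ZMod p → ZMod p` with `Δ_1^{d+1} u = 0` is a polynomial function of degree `≤ d`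
  (`exists_polynomial_of_fwdDiff_iter_eq_zero`, by `Polynomial.fwdDiff_iter_degree_eq_factorial`
  applied to the interpolating polynomial).

The constant: the printed argument needs the total failure budget
`(d+2) · 2(d+1)δ + (d+1)δ < 1`, i.e. `δ < 1/((d+1)(2d+5))`; Rubinfeld–Sudan state `δ ≤ 1/(2(d+2)²)`
(which implies it). Probabilities are kept as counts throughout (`#fails = δ |Fᵐ|²`).

## References

* R. Rubinfeld, M. Sudan, *Robust characterizations of polynomials with applications to program
  testing*, SIAM J. Comput. 25(2) (1996) 252–271, §4 (evenly spaced points test and its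
  robustness) [RubinfeldSudan1996].
* P. Gemmell, R. Lipton, R. Rubinfeld, M. Sudan, A. Wigderson, *Self-testing/correcting for
  polynomials and for approximate functions*, STOC 1991, §3 [GLRSW1991].
* S. Arora, B. Barak, *Computational Complexity: A Modern Approach*, CUP 2009, §8.6.1–8.6.2
  (multilinearity / low-degree testing in `MIP = NEXP`), Thm. 11.21 (the analogous linearity test)
  [AroraBarakCC2009].
-/

noncomputable section

open Finset fwdDiff

namespace Literature.Computability.Complexity

namespace LowDegreeTest

variable {F : Type*} [Field F] {m : ℕ}

section Test

variable (α : ℕ → F) (d : ℕ) (f : (Fin m → F) → F)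

/-! ### The test and the vote -/

/-- The test sum `∑_{i=0}^{d+1} αᵢ f(x + i•t)` of the evenly-spaced-points test at the pair
`(x, t)`; the test PASSES iff it vanishes. [cite: RubinfeldSudan1996, §4] -/
def testSum (x t : Fin m → F) : F := ∑ i ∈ range (d + 2), α i * f (x + (i : F) • t)

/-- The vote of direction `t` for the value at `x`: `-α₀⁻¹ ∑_{i=1}^{d+1} αᵢ f(x + i•t)` (the value
that makes the test at `(x, t)` pass). [cite: RubinfeldSudan1996, §4] -/
def vote (x t : Fin m → F) : F := -(α 0)⁻¹ * ∑ i ∈ Ico 1 (d + 2), α i * f (x + (i : F) • t)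

variable {α d f}

/-- The test sum splits off its `i = 0` term: `testSum = α₀ · (f x - vote_t(x))`. [folklore] -/
theorem testSum_eq (hα : α 0 ≠ 0) (x t : Fin m → F) :
    testSum α d f x t = α 0 * (f x - vote α d f x t) := by
  unfold testSum vote
  rw [sum_range_eq_add_Ico _ (by omega : 0 < d + 2)]
  simp only [Nat.cast_zero, zero_smul, add_zero]
  rw [mul_sub, ← mul_assoc, mul_neg, mul_inv_cancel₀ hα]
  ring

/-- The test at `(x, t)` fails iff the vote of `t` is not `f x`. [folklore] -/
theorem testSum_ne_zero_iff (hα : α 0 ≠ 0) (x t : Fin m → F) :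
    testSum α d f x t ≠ 0 ↔ vote α d f x t ≠ f x := by
  rw [testSum_eq hα]
  simp only [ne_eq, mul_eq_zero, hα, false_or, sub_eq_zero]
  exact ⟨fun h h' => h h'.symm, fun h h' => h h'.symm⟩

/-- The test at `(x, t)` passes iff the vote of `t` is `f x`. [folklore] -/
theorem testSum_eq_zero_iff (hα : α 0 ≠ 0) (x t : Fin m → F) :
    testSum α d f x t = 0 ↔ f x = vote α d f x t := by
  rw [testSum_eq hα, mul_eq_zero, sub_eq_zero, or_iff_right hα]

/-- If all `d + 1` tests at the points `x + i•t₁` in direction `t₂` pass, the vote of `t₁` at `x`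
is the double sum `α₀⁻² ∑ᵢ ∑ⱼ αᵢ αⱼ f(x + i•t₁ + j•t₂)`. [cite: RubinfeldSudan1996, §4] -/
theorem vote_eq_double_sum (hα : α 0 ≠ 0) (x t₁ t₂ : Fin m → F)
    (h : ∀ i ∈ Ico 1 (d + 2), testSum α d f (x + (i : F) • t₁) t₂ = 0) :
    vote α d f x t₁ = -(α 0)⁻¹ * ∑ i ∈ Ico 1 (d + 2), α i *
      (-(α 0)⁻¹ * ∑ j ∈ Ico 1 (d + 2), α j * f (x + (i : F) • t₁ + (j : F) • t₂)) := by
  unfold vote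
  congr 1
  refine sum_congr rfl fun i hi => ?_
  congr 1
  exact (testSum_eq_zero_iff hα _ _).1 (h i hi)

end Test

section Counting

variable [Fintype F] [DecidableEq F]
variable (α : ℕ → F) (d : ℕ) (f : (Fin m → F) → F)

/-! ### The failure set and the plurality decoding -/

/-- The set of failing pairs `(x, t)`. [cite: RubinfeldSudan1996, §4] -/
def fails : Finset ((Fin m → F) × (Fin m → F)) := univ.filter fun p => testSum α d f p.1 p.2 ≠ 0

/-- The failing directions at a point `x`. [folklore] -/
def failsAt (x : Fin m → F) : Finset (Fin m → F) := univ.filter fun t => testSum α d f x t ≠ 0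

/-- The number of directions voting `v` at `x`. [folklore] -/
def cnt (x : Fin m → F) (v : F) : ℕ := (univ.filter fun t : Fin m → F => vote α d f x t = v).card

/-- **Plurality decoding** `g(x)`: a value with the most votes at `x`. [cite: RubinfeldSudan1996, §4] -/
def corr (x : Fin m → F) : F :=
  Classical.choose (exists_max_image univ (cnt α d f x) ⟨0, mem_univ _⟩)

/-- The decoded value has at least as many votes as any other value. [folklore] -/
theorem cnt_le_cnt_corr (x : Fin m → F) (v : F) : cnt α d f x v ≤ cnt α d f x (corr α d f x) :=
  (Classical.choose_spec (exists_max_image univ (cnt α d f x) ⟨0, mem_univ _⟩)).2 v (mem_univ _)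

/-- The directions NOT voting for the decoded value at `x`. [folklore] -/
def badDir (x : Fin m → F) : Finset (Fin m → F) := univ.filter fun t => vote α d f x t ≠ corr α d f x

variable {α d f}

/-- `#fails = ∑ₓ #failsAt x`. [folklore] -/
theorem card_fails_eq_sum : (fails α d f).card = ∑ x, (failsAt α d f x).card := by
  unfold fails failsAt
  rw [card_filter, ← univ_product_univ, sum_product]
  simp only [card_filter]

/-! ### Step 1: the decoding is `2δ`-close -/

/-- At a point where `f` and the decoding differ, at least half of the directions fail: the votes
for `f x` are at most the votes for `g x`, and the two camps are disjoint.
[cite: RubinfeldSudan1996, §4] -/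
theorem card_le_two_mul_card_failsAt (hα : α 0 ≠ 0) {x : Fin m → F} (hx : f x ≠ corr α d f x) :
    Fintype.card (Fin m → F) ≤ 2 * (failsAt α d f x).card := by
  have hsplit : cnt α d f x (f x) + (failsAt α d f x).card = Fintype.card (Fin m → F) := by
    have h := card_filter_add_card_filter_not (s := (univ : Finset (Fin m → F)))
      (fun t => vote α d f x t = f x)
    rw [card_univ] at h
    have hfa : failsAt α d f x = univ.filter fun t => ¬ vote α d f x t = f x := by
      unfold failsAt
      congr 1
      ext t
      exact testSum_ne_zero_iff hα x t
    rw [hfa]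
    exact h
  have hle : cnt α d f x (f x) ≤ cnt α d f x (corr α d f x) := cnt_le_cnt_corr α d f x (f x)
  have hdisj : cnt α d f x (f x) + cnt α d f x (corr α d f x) ≤ Fintype.card (Fin m → F) := by
    unfold cnt
    rw [← card_union_of_disjoint (disjoint_filter.2 fun t _ h1 h2 => hx (h1.symm.trans h2))]
    exact card_le_univ _
  omega

/-- **The decoding is `2δ`-close to `f`**: `#{x | f x ≠ g x} · |Fᵐ| ≤ 2 · #fails`.
[cite: RubinfeldSudan1996, §4] -/
theorem card_ne_corr_mul_le (hα : α 0 ≠ 0) :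
    (univ.filter fun x : Fin m → F => f x ≠ corr α d f x).card * Fintype.card (Fin m → F) ≤
      2 * (fails α d f).card := by
  rw [card_fails_eq_sum, card_eq_sum_ones, sum_mul, mul_sum]
  calc ∑ x ∈ univ.filter (fun x : Fin m → F => f x ≠ corr α d f x), 1 * Fintype.card (Fin m → F)
      ≤ ∑ x ∈ univ.filter (fun x : Fin m → F => f x ≠ corr α d f x), 2 * (failsAt α d f x).card :=
        sum_le_sum fun x hx => by
          rw [one_mul]
          exact card_le_two_mul_card_failsAt hα (mem_filter.1 hx).2
    _ ≤ ∑ x, 2 * (failsAt α d f x).card :=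
        sum_le_sum_of_subset_of_nonneg (filter_subset _ _) fun _ _ _ => Nat.zero_le _

/-! ### Step 2: the vote for the decoded value is overwhelming -/

/-- **Two independent votes agree off `2(d+1)` translates of the failure set**:
`#{(t₁, t₂) | vote_{t₁}(x) ≠ vote_{t₂}(x)} ≤ 2(d+1) · #fails`. [cite: RubinfeldSudan1996, §4] -/
theorem card_vote_ne_vote_le (hα : α 0 ≠ 0) (hunit : ∀ i : ℕ, 1 ≤ i → i ≤ d + 1 → (i : F) ≠ 0)
    (x : Fin m → F) :
    (univ.filter fun p : (Fin m → F) × (Fin m → F) => vote α d f x p.1 ≠ vote α d f x p.2).card ≤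
      2 * (d + 1) * (fails α d f).card := by
  classical
  -- the translated copies of the failure set
  set E : ℕ → Finset ((Fin m → F) × (Fin m → F)) := fun i =>
    (fails α d f).image fun q => (((i : F)⁻¹) • (q.1 - x), q.2) with hE
  set E' : ℕ → Finset ((Fin m → F) × (Fin m → F)) := fun j =>
    (fails α d f).image fun q => (q.2, ((j : F)⁻¹) • (q.1 - x)) with hE'
  have hsub : (univ.filter fun p : (Fin m → F) × (Fin m → F) => vote α d f x p.1 ≠ vote α d f x p.2) ⊆
      (Ico 1 (d + 2)).biUnion E ∪ (Ico 1 (d + 2)).biUnion E' := by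
    intro p hp
    rw [mem_filter] at hp
    by_contra hnot
    rw [mem_union, not_or, mem_biUnion, mem_biUnion, not_exists, not_exists] at hnot
    obtain ⟨h1, h2⟩ := hnot
    -- all tests at `x + i t₁` in direction `t₂` pass, and symmetrically
    have hpass1 : ∀ i ∈ Ico 1 (d + 2), testSum α d f (x + (i : F) • p.1) p.2 = 0 := by
      intro i hi
      by_contra hne
      refine h1 i ⟨hi, ?_⟩
      rw [hE, mem_image]
      refine ⟨(x + (i : F) • p.1, p.2), mem_filter.2 ⟨mem_univ _, hne⟩, ?_⟩
      have hi0 : (i : F) ≠ 0 := hunit i (mem_Ico.1 hi).1 (by have := (mem_Ico.1 hi).2; omega)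
      ext1
      · simp only [add_sub_cancel_left, smul_smul, inv_mul_cancel₀ hi0, one_smul]
      · rfl
    have hpass2 : ∀ j ∈ Ico 1 (d + 2), testSum α d f (x + (j : F) • p.2) p.1 = 0 := by
      intro j hj
      by_contra hne
      refine h2 j ⟨hj, ?_⟩
      rw [hE', mem_image]
      refine ⟨(x + (j : F) • p.2, p.1), mem_filter.2 ⟨mem_univ _, hne⟩, ?_⟩
      have hj0 : (j : F) ≠ 0 := hunit j (mem_Ico.1 hj).1 (by have := (mem_Ico.1 hj).2; omega)
      ext1
      · rfl
      · simp only [add_sub_cancel_left, smul_smul, inv_mul_cancel₀ hj0, one_smul]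
    refine hp.2 ?_
    rw [vote_eq_double_sum hα x p.1 p.2 hpass1, vote_eq_double_sum hα x p.2 p.1 hpass2]
    congr 1
    simp only [mul_sum]
    rw [sum_comm]
    refine sum_congr rfl fun j _ => sum_congr rfl fun i _ => ?_
    rw [add_right_comm]
    ring
  calc (univ.filter fun p : (Fin m → F) × (Fin m → F) => vote α d f x p.1 ≠ vote α d f x p.2).card
      ≤ ((Ico 1 (d + 2)).biUnion E ∪ (Ico 1 (d + 2)).biUnion E').card := card_le_card hsub
    _ ≤ ((Ico 1 (d + 2)).biUnion E).card + ((Ico 1 (d + 2)).biUnion E').card := card_union_le _ _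
    _ ≤ ∑ i ∈ Ico 1 (d + 2), (E i).card + ∑ j ∈ Ico 1 (d + 2), (E' j).card :=
        Nat.add_le_add card_biUnion_le card_biUnion_le
    _ ≤ ∑ _i ∈ Ico 1 (d + 2), (fails α d f).card + ∑ _j ∈ Ico 1 (d + 2), (fails α d f).card :=
        Nat.add_le_add (sum_le_sum fun i _ => card_image_le) (sum_le_sum fun j _ => card_image_le)
    _ = 2 * (d + 1) * (fails α d f).card := by
        have hIco : (Ico 1 (d + 2)).card = d + 1 := by have := Nat.card_Ico 1 (d + 2); omega
        rw [sum_const, hIco, smul_eq_mul]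
        ring

/-- The votes at `x` partition the directions: `∑ᵥ cntₓ(v) = |Fᵐ|`. [folklore] -/
theorem sum_cnt_eq (x : Fin m → F) : ∑ v, cnt α d f x v = Fintype.card (Fin m → F) := by
  unfold cnt
  rw [← card_univ, card_eq_sum_card_fiberwise (f := fun t => vote α d f x t) (t := univ)
    fun _ _ => mem_univ _]

/-- **Collision count**: `#{(t₁, t₂) | vote_{t₁}(x) = vote_{t₂}(x)} = ∑ᵥ cntₓ(v)²`. [folklore] -/
theorem card_vote_eq_vote (x : Fin m → F) :
    (univ.filter fun p : (Fin m → F) × (Fin m → F) => vote α d f x p.1 = vote α d f x p.2).card =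
      ∑ v, cnt α d f x v * cnt α d f x v := by
  rw [card_eq_sum_card_fiberwise (f := fun p : (Fin m → F) × (Fin m → F) => vote α d f x p.1)
    (t := univ) fun _ _ => mem_univ _]
  refine sum_congr rfl fun v _ => ?_
  unfold cnt
  rw [← card_product]
  congr 1
  ext p
  simp only [mem_filter, mem_univ, true_and, mem_product]
  constructor
  · rintro ⟨h1, h2⟩
    exact ⟨h2, h1.symm.trans h2⟩
  · rintro ⟨h1, h2⟩
    exact ⟨h1.trans h2.symm, h1⟩

/-- **The vote for the decoded value is overwhelming**: for every `x`,
`#{t | vote_t(x) ≠ g x} · |Fᵐ| ≤ 2(d+1) · #fails`. The pairs `(t₁, t₂)` split into agreeing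
pairs, at most `c_max · |Fᵐ|` by the collision count, and disagreeing pairs, at most
`2(d+1) #fails`. [cite: RubinfeldSudan1996, §4] -/
theorem card_vote_ne_mul_le (hα : α 0 ≠ 0) (hunit : ∀ i : ℕ, 1 ≤ i → i ≤ d + 1 → (i : F) ≠ 0)
    (x : Fin m → F) :
    (badDir α d f x).card * Fintype.card (Fin m → F) ≤ 2 * (d + 1) * (fails α d f).card := by
  -- agreeing pairs: at most `c_max · |Fᵐ|`
  have hagree : (univ.filter fun p : (Fin m → F) × (Fin m → F) =>
      vote α d f x p.1 = vote α d f x p.2).card ≤ cnt α d f x (corr α d f x) * Fintype.card (Fin m → F) := by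
    rw [card_vote_eq_vote, ← sum_cnt_eq (α := α) (d := d) (f := f) x, mul_sum]
    exact sum_le_sum fun v _ => Nat.mul_le_mul_right _ (cnt_le_cnt_corr α d f x v)
  -- all pairs
  have htot : (univ.filter fun p : (Fin m → F) × (Fin m → F) => vote α d f x p.1 = vote α d f x p.2).card +
      (univ.filter fun p : (Fin m → F) × (Fin m → F) => ¬ vote α d f x p.1 = vote α d f x p.2).card =
        Fintype.card (Fin m → F) * Fintype.card (Fin m → F) := by
    rw [card_filter_add_card_filter_not, card_univ, Fintype.card_prod]
  -- disagreeing pairs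
  have hne : (univ.filter fun p : (Fin m → F) × (Fin m → F) => ¬ vote α d f x p.1 = vote α d f x p.2).card ≤
      2 * (d + 1) * (fails α d f).card := card_vote_ne_vote_le hα hunit x
  -- the bad directions are the complement of the camp of the decoded value
  have hbad : (badDir α d f x).card + cnt α d f x (corr α d f x) = Fintype.card (Fin m → F) := by
    have h := card_filter_add_card_filter_not (s := (univ : Finset (Fin m → F)))
      (fun t => vote α d f x t = corr α d f x)
    rw [card_univ] at h
    unfold badDir cnt
    show (univ.filter fun t => ¬ vote α d f x t = corr α d f x).card +
      (univ.filter fun t => vote α d f x t = corr α d f x).card = _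
    omega
  have hsplit : (badDir α d f x).card * Fintype.card (Fin m → F) +
      cnt α d f x (corr α d f x) * Fintype.card (Fin m → F) =
        Fintype.card (Fin m → F) * Fintype.card (Fin m → F) := by
    rw [← Nat.add_mul, hbad]
  linarith

/-! ### Step 3: the decoding passes the test everywhere -/

/-- **The decoding passes every test** when `(d+1)(2d+5) · #fails < |Fᵐ|²`. For fixed `(x, t)` a
pair `(t₁, t₂)` is good if every vote `vote_{t₁ + i t₂}(x + i t)` (`0 ≤ i ≤ d + 1`) is the decoded
value and every test at `(x + j t₁, t + j t₂)` (`1 ≤ j ≤ d + 1`) passes; good pairs exist by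
counting (`card_vote_ne_mul_le` and `d + 1` copies of the failure set), and for a good pair the test
sum of `g` at `(x, t)` is `-α₀⁻¹ ∑ⱼ αⱼ · testSum f (x + j t₁) (t + j t₂) = 0`, reading the grid
`x + i t + j (t₁ + i t₂) = (x + j t₁) + i (t + j t₂)` by rows and by columns.
[cite: RubinfeldSudan1996, §4] -/
theorem testSum_corr_eq_zero (hα : α 0 ≠ 0) (hunit : ∀ i : ℕ, 1 ≤ i → i ≤ d + 1 → (i : F) ≠ 0)
    (hsmall : (d + 1) * (2 * d + 5) * (fails α d f).card < Fintype.card (Fin m → F) ^ 2)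
    (x t : Fin m → F) : testSum α d (corr α d f) x t = 0 := by
  classical
  set N := Fintype.card (Fin m → F) with hN
  -- bad events
  set B : ℕ → Finset ((Fin m → F) × (Fin m → F)) := fun i =>
    (badDir α d f (x + (i : F) • t) ×ˢ (univ : Finset (Fin m → F))).image
      fun q => (q.1 - (i : F) • q.2, q.2) with hB
  set C : ℕ → Finset ((Fin m → F) × (Fin m → F)) := fun j =>
    (fails α d f).image fun q => (((j : F)⁻¹) • (q.1 - x), ((j : F)⁻¹) • (q.2 - t)) with hC
  set bad := (range (d + 2)).biUnion B ∪ (Ico 1 (d + 2)).biUnion C with hbad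
  -- counting: the bad pairs are fewer than all pairs
  have hBcard : ∀ i, (B i).card * N ≤ 2 * (d + 1) * (fails α d f).card * N := fun i => by
    have h1 : (B i).card ≤ (badDir α d f (x + (i : F) • t)).card * N :=
      card_image_le.trans (by rw [card_product, card_univ])
    calc (B i).card * N ≤ (badDir α d f (x + (i : F) • t)).card * N * N := Nat.mul_le_mul_right _ h1
      _ ≤ 2 * (d + 1) * (fails α d f).card * N :=
          Nat.mul_le_mul_right _ (card_vote_ne_mul_le hα hunit _)
  have hCcard : ∀ j, (C j).card ≤ (fails α d f).card := fun j => card_image_le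
  have hbadcard : bad.card * N ≤ (d + 1) * (2 * d + 5) * (fails α d f).card * N := by
    have h1 : bad.card ≤ ∑ i ∈ range (d + 2), (B i).card + ∑ j ∈ Ico 1 (d + 2), (C j).card :=
      (card_union_le _ _).trans (Nat.add_le_add card_biUnion_le card_biUnion_le)
    have h2 : (∑ i ∈ range (d + 2), (B i).card) * N ≤ (d + 2) * (2 * (d + 1) * (fails α d f).card * N) := by
      rw [sum_mul]
      calc ∑ i ∈ range (d + 2), (B i).card * N
          ≤ ∑ _i ∈ range (d + 2), 2 * (d + 1) * (fails α d f).card * N := sum_le_sum fun i _ => hBcard i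
        _ = (d + 2) * (2 * (d + 1) * (fails α d f).card * N) := by rw [sum_const, card_range, smul_eq_mul]
    have h3 : ∑ j ∈ Ico 1 (d + 2), (C j).card ≤ (d + 1) * (fails α d f).card := by
      calc ∑ j ∈ Ico 1 (d + 2), (C j).card ≤ ∑ _j ∈ Ico 1 (d + 2), (fails α d f).card :=
            sum_le_sum fun j _ => hCcard j
        _ = (d + 1) * (fails α d f).card := by
            have hIco : (Ico 1 (d + 2)).card = d + 1 := by have := Nat.card_Ico 1 (d + 2); omega
            rw [sum_const, hIco, smul_eq_mul]
    calc bad.card * N ≤ (∑ i ∈ range (d + 2), (B i).card + ∑ j ∈ Ico 1 (d + 2), (C j).card) * N :=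
          Nat.mul_le_mul_right _ h1
      _ = (∑ i ∈ range (d + 2), (B i).card) * N + (∑ j ∈ Ico 1 (d + 2), (C j).card) * N := Nat.add_mul _ _ _
      _ ≤ (d + 2) * (2 * (d + 1) * (fails α d f).card * N) + (d + 1) * (fails α d f).card * N :=
          Nat.add_le_add h2 (Nat.mul_le_mul_right _ h3)
      _ = (d + 1) * (2 * d + 5) * (fails α d f).card * N := by ring
  have hlt : bad.card < (univ : Finset ((Fin m → F) × (Fin m → F))).card := by
    rw [card_univ, Fintype.card_prod, ← hN]
    rcases Nat.eq_zero_or_pos N with hN0 | hNpos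
    · exfalso
      rw [hN0] at hsmall
      simp at hsmall
    · have : bad.card * N < N ^ 2 * N := by
        calc bad.card * N ≤ (d + 1) * (2 * d + 5) * (fails α d f).card * N := hbadcard
          _ < N ^ 2 * N := Nat.mul_lt_mul_of_pos_right hsmall hNpos
      rw [sq] at this
      exact Nat.lt_of_mul_lt_mul_right this
  obtain ⟨p, -, hp⟩ := exists_mem_notMem_of_card_lt_card hlt
  rw [hbad, mem_union, not_or, mem_biUnion, mem_biUnion, not_exists, not_exists] at hp
  obtain ⟨hpB, hpC⟩ := hp
  -- the good pair: every grid vote is the decoded value ...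
  have hvote : ∀ i ∈ range (d + 2),
      corr α d f (x + (i : F) • t) = vote α d f (x + (i : F) • t) (p.1 + (i : F) • p.2) := by
    intro i hi
    by_contra hne
    refine hpB i ⟨hi, ?_⟩
    rw [hB, mem_image]
    refine ⟨(p.1 + (i : F) • p.2, p.2), mem_product.2 ⟨mem_filter.2 ⟨mem_univ _, fun h => hne h.symm⟩,
      mem_univ _⟩, ?_⟩
    ext1
    · simp only [add_sub_cancel_right]
    · rfl
  -- ... and every column test passes
  have hcol : ∀ j ∈ Ico 1 (d + 2), testSum α d f (x + (j : F) • p.1) (t + (j : F) • p.2) = 0 := by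
    intro j hj
    by_contra hne
    refine hpC j ⟨hj, ?_⟩
    rw [hC, mem_image]
    refine ⟨(x + (j : F) • p.1, t + (j : F) • p.2), mem_filter.2 ⟨mem_univ _, hne⟩, ?_⟩
    have hj0 : (j : F) ≠ 0 := hunit j (mem_Ico.1 hj).1 (by have := (mem_Ico.1 hj).2; omega)
    ext1
    · simp only [add_sub_cancel_left, smul_smul, inv_mul_cancel₀ hj0, one_smul]
    · simp only [add_sub_cancel_left, smul_smul, inv_mul_cancel₀ hj0, one_smul]
  -- read the grid by rows, then by columns
  calc testSum α d (corr α d f) x t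
      = ∑ i ∈ range (d + 2), α i * (-(α 0)⁻¹ * ∑ j ∈ Ico 1 (d + 2), α j *
          f (x + (i : F) • t + (j : F) • (p.1 + (i : F) • p.2))) := by
        unfold testSum
        refine sum_congr rfl fun i hi => ?_
        rw [hvote i hi]
        rfl
    _ = -(α 0)⁻¹ * ∑ j ∈ Ico 1 (d + 2), α j * testSum α d f (x + (j : F) • p.1) (t + (j : F) • p.2) := by
        unfold testSum
        simp only [mul_sum]
        rw [sum_comm]
        refine sum_congr rfl fun j _ => sum_congr rfl fun i _ => ?_
        have hgrid : x + (i : F) • t + (j : F) • (p.1 + (i : F) • p.2) =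
            x + (j : F) • p.1 + (i : F) • (t + (j : F) • p.2) := by
          simp only [smul_add, smul_smul, mul_comm (j : F) (i : F)]
          abel
        rw [hgrid]
        ring
    _ = 0 := by
        rw [sum_eq_zero fun j hj => ?_, mul_zero]
        rw [hcol j hj, mul_zero]

/-- **Rubinfeld–Sudan robustness of the evenly-spaced-points test** (counting form). Let
`α₀ ≠ 0` and `1, …, d+1 ≠ 0` in the finite field `F`. If the test `∑_{i ≤ d+1} αᵢ f(x + i•t) = 0`
fails on fewer than `|Fᵐ|² / ((d+1)(2d+5))` of the pairs `(x, t) ∈ Fᵐ × Fᵐ`, then there is a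
function `g` passing the test at EVERY pair and differing from `f` on at most a `2δ` fraction of the
points, `δ = #fails / |Fᵐ|²`. [Rubinfeld–Sudan 1996, §4 (robustness of the evenly spaced points
test, constant `1/(2(d+2)²)`); Gemmell–Lipton–Rubinfeld–Sudan–Wigderson 1991, §3]
[cite: RubinfeldSudan1996, §4] -/
theorem robust (α : ℕ → F) (d : ℕ) (f : (Fin m → F) → F) (hα : α 0 ≠ 0)
    (hunit : ∀ i : ℕ, 1 ≤ i → i ≤ d + 1 → (i : F) ≠ 0)
    (hsmall : (d + 1) * (2 * d + 5) * (fails α d f).card < Fintype.card (Fin m → F) ^ 2) :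
    ∃ g : (Fin m → F) → F,
      (univ.filter fun x : Fin m → F => f x ≠ g x).card * Fintype.card (Fin m → F) ≤ 2 * (fails α d f).card ∧
      ∀ x t : Fin m → F, testSum α d g x t = 0 :=
  ⟨corr α d f, card_ne_corr_mul_le hα, testSum_corr_eq_zero hα hunit hsmall⟩

end Counting

/-! ### The finite-difference instance -/

section FiniteDifference

/-- The coefficients of the `(d+1)`-st finite difference: `αᵢ = (-1)^{d+1-i} · (d+1 choose i)`.
[cite: RubinfeldSudan1996, §4] -/
def diffCoeff (d : ℕ) (i : ℕ) : F := (-1 : F) ^ (d + 1 - i) * ((d + 1).choose i : F)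

/-- `α₀ = (-1)^{d+1} ≠ 0`. [folklore] -/
theorem diffCoeff_zero_ne (d : ℕ) : (diffCoeff d 0 : F) ≠ 0 := by
  simp [diffCoeff]

/-- **The test sum with the finite-difference coefficients is the iterated forward difference**
`Δ_[t]^[d+1] f x` (Mathlib's `fwdDiff_iter_eq_sum_shift`). [cite: RubinfeldSudan1996, §4] -/
theorem testSum_diffCoeff (d : ℕ) (f : (Fin m → F) → F) (x t : Fin m → F) :
    testSum (diffCoeff d) d f x t = (fwdDiff t)^[d + 1] f x := by
  rw [fwdDiff_iter_eq_sum_shift, testSum]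
  refine sum_congr rfl fun i _ => ?_
  rw [diffCoeff, zsmul_eq_mul, Nat.cast_smul_eq_nsmul]
  push_cast
  ring

/-- **Completeness**: a polynomial of total degree `≤ d` passes every test — along the line
`s ↦ x + s•t` it is a one-variable polynomial of degree `≤ d`, killed by `Δ^{d+1}`
(`Polynomial.fwdDiff_iter_eq_zero_of_degree_lt`). [cite: RubinfeldSudan1996, §4] -/
theorem fwdDiff_iter_eval_eq_zero {d : ℕ} (P : MvPolynomial (Fin m) F) (hP : P.totalDegree ≤ d)
    (x t : Fin m → F) : (fwdDiff t)^[d + 1] (fun y => MvPolynomial.eval y P) x = 0 := by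
  -- the line polynomial
  set Q : Polynomial F := MvPolynomial.aeval (fun i => Polynomial.C (x i) + Polynomial.C (t i) * Polynomial.X) P
    with hQ
  have hQeval : ∀ s : F, Q.eval s = MvPolynomial.eval (x + s • t) P := by
    intro s
    rw [hQ, ← Polynomial.coe_aeval_eq_eval, ← AlgHom.comp_apply, MvPolynomial.comp_aeval]
    show MvPolynomial.eval _ P = _
    have hg : (fun i => Polynomial.aeval s (Polynomial.C (x i) + Polynomial.C (t i) * Polynomial.X)) =
        x + s • t := by
      funext i
      simp only [map_add, map_mul, Polynomial.aeval_C, Polynomial.aeval_X, Algebra.algebraMap_self,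
        RingHom.id_apply, Pi.add_apply, Pi.smul_apply, smul_eq_mul]
      ring
    rw [hg]
  have hQdeg : Q.natDegree ≤ d := by
    refine le_trans ?_ hP
    rw [hQ, MvPolynomial.aeval_def, MvPolynomial.eval₂_eq]
    refine Polynomial.natDegree_sum_le_of_forall_le _ _ fun e he => ?_
    refine Polynomial.natDegree_mul_le.trans ?_
    rw [Polynomial.algebraMap_apply, Polynomial.natDegree_C, zero_add]
    refine (Polynomial.natDegree_prod_le _ _).trans ?_
    refine le_trans (sum_le_sum fun i _ => Polynomial.natDegree_pow_le.trans
      (Nat.mul_le_mul_left (e i) (show (Polynomial.C (x i) + Polynomial.C (t i) * Polynomial.X).natDegree ≤ 1 from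
        (Polynomial.natDegree_add_le _ _).trans (max_le (by simp)
          (Polynomial.natDegree_C_mul_le _ _ |>.trans Polynomial.natDegree_X_le))))) ?_
    simp only [mul_one]
    exact MvPolynomial.le_totalDegree he
  -- both iterated differences are the same combination of values on the line
  have h1 : (fwdDiff t)^[d + 1] (fun y => MvPolynomial.eval y P) x = (fwdDiff (1 : F))^[d + 1] Q.eval 0 := by
    rw [fwdDiff_iter_eq_sum_shift, fwdDiff_iter_eq_sum_shift]
    refine sum_congr rfl fun k _ => ?_
    rw [hQeval, zero_add, Nat.smul_one_eq_cast, Nat.cast_smul_eq_nsmul]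
  rw [h1, Polynomial.fwdDiff_iter_eq_zero_of_degree_lt (by omega : Q.natDegree < d + 1)]
  rfl

/-- **Decoding on lines over a prime field**: if `u : ZMod p → ZMod p` satisfies
`Δ_1^{d+1} u = 0`, then `u` is a polynomial function of degree `≤ d` — the interpolating
polynomial `P` of `u` has degree `< p`, and if its degree `e` exceeded `d` then
`Δ^{e} u = lc(P) · e! ≠ 0` (`Polynomial.fwdDiff_iter_degree_eq_factorial`, `e!` is a unit
modulo the prime `p > e`), contradicting `Δ^{e} u = Δ^{e-d-1} Δ^{d+1} u = 0`. (No hypothesis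
`d < p` is needed: for `d ≥ p - 1` every function passes and every function is a polynomial
function of degree `≤ p - 1`.) [cite: RubinfeldSudan1996, §4] -/
theorem exists_polynomial_of_fwdDiff_iter_eq_zero {p : ℕ} [Fact p.Prime] {d : ℕ}
    (u : ZMod p → ZMod p) (hu : (fwdDiff (1 : ZMod p))^[d + 1] u = 0) :
    ∃ P : Polynomial (ZMod p), P.natDegree ≤ d ∧ ∀ s, u s = P.eval s := by
  classical
  -- the interpolating polynomial
  set P : Polynomial (ZMod p) := Lagrange.interpolate univ id u with hP
  have hPeval : ∀ s, u s = P.eval s := fun s => by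
    rw [hP]
    exact (Lagrange.eval_interpolate_at_node (s := univ) (v := id) u (fun _ _ _ _ h => h) (mem_univ s)).symm
  have hPdeg : P.natDegree < p := by
    have h := Lagrange.degree_interpolate_lt (s := (univ : Finset (ZMod p))) (v := id) u
      (fun _ _ _ _ h => h)
    rw [card_univ, ZMod.card] at h
    rcases eq_or_ne P 0 with h0 | h0
    · rw [h0, Polynomial.natDegree_zero]
      exact (Fact.out : p.Prime).pos
    · exact (Polynomial.natDegree_lt_iff_degree_lt h0).2 h
  refine ⟨P, ?_, hPeval⟩
  by_contra hlt
  rw [not_le] at hlt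
  -- `Δ^{deg P} u = lc(P) · (deg P)! ≠ 0`
  have hfun : u = P.eval := funext hPeval
  have hdiff := Polynomial.fwdDiff_iter_degree_eq_factorial P
  rw [← hfun] at hdiff
  obtain ⟨k, hk⟩ := Nat.exists_eq_add_of_lt hlt
  have hzero : (fwdDiff (1 : ZMod p))^[P.natDegree] u = 0 := by
    rw [hk, show d + k + 1 = k + (d + 1) by ring, Function.iterate_add_apply, hu]
    clear hk hdiff
    induction k with
    | zero => rfl
    | succ k ih =>
      rw [Function.iterate_succ_apply', ih]
      funext y
      simp [fwdDiff]
  rw [hzero] at hdiff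
  have hval := congr_fun hdiff 0
  simp only [Pi.zero_apply, Pi.smul_apply, smul_eq_mul, Pi.natCast_apply] at hval
  have hlc : P.leadingCoeff ≠ 0 := by
    rw [Ne, Polynomial.leadingCoeff_eq_zero]
    intro h0
    rw [h0, Polynomial.natDegree_zero] at hlt
    exact Nat.not_lt_zero _ hlt
  have hfac : ((P.natDegree).factorial : ZMod p) ≠ 0 := by
    rw [Ne, CharP.cast_eq_zero_iff (ZMod p) p]
    exact fun h => absurd ((Nat.Prime.dvd_factorial (Fact.out : p.Prime)).1 h) (not_le.2 hPdeg)
  exact mul_ne_zero hlc hfac (by exact_mod_cast hval.symm)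

end FiniteDifference

end LowDegreeTest

end Literature.Computability.Complexity

end
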